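import Summits.BirchSwinnertonDyer.BirchSwinnertonDyer.Theorems.PrintX10bControlBottomClassNonvanishing
import Literature.NumberTheory.EllipticCurves.IwasawaAlgebraSpecializationFiniteKernelSeparationProofs
import HarnessLib

/-!
# A NON-ZERO class of `𝔖_p(K_∞)` has NON-ZERO compact control images `f_m z ∈ H¹(K, T_{q_m})` for every `m ≫ 0` —
# with NO hypothesis on `𝔖` (no finite generation, no `𝔖/Λz` torsion, no control kernel)

Summits-side helper toward crux r205 stmt-BirchSwinnertonDyer-24737 `…Theses.UniversalToricDescent.TwinAlgMuZeroAtThree`, line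
`beta-road` v14 (LEAD lineage `bsd-wall-utd-p1`, g27; `--supports`): the clause `κ₁ = f_m(𝐳_∞) ≠ 0` of the registered research stub
`stub_ksTwin` holds for `m ≫ 0` as soon as `𝐳_∞ ≠ 0`.  ROUTE-INDEPENDENT; THEOREMS ONLY (no definition, no named fact, no instance,
no `sorry`).  Strengthens x10b's `PrintX10bCompactControl.exists_forall_toEisensteinH1Linear_ne_zero` (p660565), which needed
`Module.Finite Λ 𝔖` AND `𝔖/Λz` torsion: here `z ≠ 0` alone suffices.

WHAT (for `V/K` elliptic, `E(K)[p] = 0`, `γ` a topological generator, `D` a `Λ`-adic Selmer datum, sign `κ⁻ = κ.unitTwist (-1)`):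
* `proj_natCast_pow_smul_apply_eq_zero` — `proj_n (p^k • w)_k = 0` (constants act on the `k`-th component through `ℤ_p → ℤ/p^k`).
* `exists_eq_natCast_pow_smul_and_not_mem` — a non-zero `z ∈ 𝔖` is `p^j • z′` with `z′ ∉ p𝔖` (the `p`-divisibility depth of `z`
  is bounded by any precision `k` at which a component of `z` is non-zero; no finite generation needed).
* **`exists_forall_toEisensteinH1Linear_ne_zero_of_ne_zero`** — `z ≠ 0 ⟹ ∃ n₁, ∀ m ≥ p^{n₁}, ∀ t ht I, f_m z ≠ 0`: `z′ ∉ p𝔖` has a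
  non-zero mod-`p` component at some layer `n₁` (x10b `exists_proj_one_ne_zero_of_not_mem`), so `f_m z′ ∉ T^{p^{n₁}}·H¹(K, T_{q_m})`
  (p655750), in particular `f_m z′ ≠ 0`; and `f_m z = p^j • f_m z′ ≠ 0` because the pinned `H¹(K, T_{q_m})` is `S_m`-torsion-free
  (`eisensteinH1Data_eq_zero_of_smul_eq_zero_of_mk_ne_zero`, `q_m ∤ p^j`).
No summit statement is proved; BSD is not proved by any of this.

References: [Howard2004HeegnerKolyvagin] Lemma 2.2.9 and proof of Thm. 2.2.10 (arXiv:1202.6340 p. 17 L60–92: «κ₁^{(𝔭)} generates an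
infinite S_𝔭-submodule for all but finitely many 𝔭»); [PerrinRiou1987BSMF] §0 p. 402; [GreenbergLNM1716] §4 p. 109.
-/

set_option linter.dupNamespace false
set_option autoImplicit false

noncomputable section

open scoped Classical ContRepresentation

namespace Summit.BirchSwinnertonDyer.BirchSwinnertonDyer.Theorems.UniversalToricDescentControlImageNonvanishing

open WeierstrassCurve Literature.NumberTheory.EllipticCurves Literature.NumberTheory.GaloisRepresentations
open Literature.NumberTheory.EllipticCurves.IwasawaAlgebra
open Summit.BirchSwinnertonDyer.BirchSwinnertonDyer.Theorems


variable {K : Type} [Field K] [NumberField K] {V : WeierstrassCurve K} [V.IsElliptic] {p : ℕ} [hp : Fact p.Prime]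
  {κ : ZpExtension K p} {γ : Field.absoluteGaloisGroup K}

omit [V.IsElliptic] in
/-- **Precision-`k` components of `p^k`-multiples vanish**: `proj_n (p^k • w)_k = 0` in `H¹(Γ_{K_n}, E[p^k])` (constants act on the `k`-th
component through `ℤ_p → ℤ/p^k`, `LambdaAdicSelmerData.proj_C`). [cite: PerrinRiou1987BSMF, §0 p. 401] -/
theorem proj_natCast_pow_smul_apply_eq_zero (D : V.LambdaAdicSelmerData κ γ) (n k : ℕ) (w : D.S) :
    D.proj n (((p : IwasawaAlgebra p) ^ k) • w) k = 0 := by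
  rw [show ((p : IwasawaAlgebra p) ^ k) = PowerSeries.C ((p : ℤ_[p]) ^ k) by rw [map_pow, map_natCast], D.proj_C]
  change (((PadicInt.toZModPow k ((p : ℤ_[p]) ^ k)).val : ℤ)) • D.proj n w k = 0
  have h0 : ((p : ZMod (p ^ k)) ^ k) = 0 := by
    have h := ZMod.natCast_self (p ^ k)
    push_cast at h
    exact h
  rw [map_pow, map_natCast, h0, ZMod.val_zero, Nat.cast_zero, zero_smul]

omit [V.IsElliptic] in
/-- **Bounded `p`-divisibility depth**: a non-zero `z ∈ 𝔖_p(K_∞)` is `p^j • z′` with `z′ ∉ p𝔖` — some component `proj_n(z)_k` is non-zero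
(joint injectivity `ext`), which forbids `z ∈ p^k 𝔖`; take `j` maximal with `z ∈ p^j 𝔖`.  No finite generation is used.
[cite: PerrinRiou1987BSMF, §0 p. 402] -/
theorem exists_eq_natCast_pow_smul_and_not_mem (D : V.LambdaAdicSelmerData κ γ) {z : D.S} (hz : z ≠ 0) :
    ∃ (j : ℕ) (z' : D.S), z = ((p : IwasawaAlgebra p) ^ j) • z' ∧
      z' ∉ (Ideal.span {(p : IwasawaAlgebra p)} • ⊤ : Submodule (IwasawaAlgebra p) D.S) := by
  -- a non-zero component `proj n₀ z k₀`
  have hex : ∃ n k, D.proj n z k ≠ 0 := by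
    by_contra h
    push Not at h
    exact hz (D.ext z fun n ↦ funext fun k ↦ h n k)
  obtain ⟨n₀, k₀, hnk⟩ := hex
  -- `z ∉ p^{k₀} 𝔖`
  have hP : ∃ j, ¬ ∃ z' : D.S, z = ((p : IwasawaAlgebra p) ^ j) • z' := by
    refine ⟨k₀, ?_⟩
    rintro ⟨z', hz'⟩
    apply hnk
    rw [hz']
    exact proj_natCast_pow_smul_apply_eq_zero D n₀ k₀ z'
  -- the least `j₁` with `z ∉ p^{j₁} 𝔖` is positive; `j = j₁ - 1`
  let j₁ := Nat.find hP
  have hj₁ : ¬ ∃ z' : D.S, z = ((p : IwasawaAlgebra p) ^ j₁) • z' := Nat.find_spec hP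
  have hj₁pos : 0 < j₁ := by
    rw [Nat.pos_iff_ne_zero]
    intro h0
    apply hj₁
    exact ⟨z, by rw [h0, pow_zero, one_smul]⟩
  obtain ⟨j, hj⟩ : ∃ j, j₁ = j + 1 := Nat.exists_eq_add_one.mpr hj₁pos
  have hjlt : j < j₁ := by omega
  have hPj : ∃ z' : D.S, z = ((p : IwasawaAlgebra p) ^ j) • z' := by
    have h := Nat.find_min hP hjlt
    push Not at h
    obtain ⟨z', hz'⟩ := h
    exact ⟨z', hz'⟩
  obtain ⟨z', rfl⟩ := hPj
  refine ⟨j, z', rfl, fun hmem ↦ hj₁ ?_⟩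
  rw [Submodule.ideal_span_singleton_smul, Submodule.mem_smul_pointwise_iff_exists] at hmem
  obtain ⟨w, -, hw⟩ := hmem
  refine ⟨w, ?_⟩
  rw [← hw, smul_smul, ← pow_succ, ← hj]

/-- **`z ≠ 0 ⟹ f_m z ≠ 0` for all `m ≥ p^{n₁}`, every transition datum and every pin** (`E(K)[p] = 0`, `γ` a topological generator;
NO hypothesis on `𝔖`): write `z = p^j • z′` with `z′ ∉ p𝔖`; some mod-`p` component `(proj_{n₁} z′)_1` is non-zero, so
`f_m z′ ∉ T^{p^{n₁}}·H¹(K, T_{q_m})` for `m ≥ p^{n₁}` (hence `f_m z′ ≠ 0`), and `f_m z = p^j • f_m z′ ≠ 0` since the pinned `H¹(K, T_{q_m})` is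
`S_m`-torsion-free and `q_m ∤ p^j`. [cite: Howard2004HeegnerKolyvagin, Lemma 2.2.9 and proof of Thm. 2.2.10 (arXiv:1202.6340 p. 17 L60–92)]
[cite: GreenbergLNM1716, §4 p. 109] -/
theorem exists_forall_toEisensteinH1Linear_ne_zero_of_ne_zero (D : V.LambdaAdicSelmerData κ γ)
    (hγ : κ.IsTopGenerator γ) (hE : ∀ P : V.toAffine.Point, p • P = 0 → P = 0) {z : D.S} (hz : z ≠ 0) :
    ∃ n₁ : ℕ, ∀ {m : ℕ} (hm : 1 ≤ m)
      (t : ∀ k, (V.torsionGaloisModule ((p : ℤ) ^ (k + 1))).toContRepresentation →ⁱL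
        (V.torsionGaloisModule ((p : ℤ) ^ k)).toContRepresentation)
      (ht : ∀ k (P : geomTorsion V ((p : ℤ) ^ (k + 1))), t k P = V.geomTorsionReduce p k P)
      (I : ZpExtension.EisensteinH1Data (κ.unitTwist (-1)) (fun k ↦ V.torsionGaloisModule ((p : ℤ) ^ k)) t hm),
      p ^ n₁ ≤ m → D.toEisensteinH1Linear hm t ht I hγ hE z ≠ 0 := by
  obtain ⟨j, z', rfl, hz'⟩ := exists_eq_natCast_pow_smul_and_not_mem D hz
  have hnt : ∀ n, ∀ P ∈ V.fixedGeomPoints (κ.layerSubgroup n), (p : ℤ) • P = 0 → P = 0 :=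
    fun n P hP hp0 ↦ LambdaAdicSelmerData.noPTorsion_layer κ hE n P ((mem_fixedGeomPoints_iff P).1 hP) hp0
  obtain ⟨n₁, hn₁⟩ := PrintX10bModPDivision.exists_proj_one_ne_zero_of_not_mem D hnt z' hz'
  refine ⟨n₁, ?_⟩
  intro m hm t ht I hle h0
  letI := IwasawaAlgebra.isDomain_quotient_X_pow_add_C p hm
  letI := IwasawaAlgebra.isDiscreteValuationRing_quotient_X_pow_add_C p hm
  -- `f_m z′ ≠ 0`
  have hnd := D.toEisensteinH1Linear_not_mem_X_pow_smul_top hm t ht I hγ hE hle z' hn₁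
  have hz'0 : D.toEisensteinH1Linear hm t ht I hγ hE z' ≠ 0 := by
    intro h
    exact hnd (by rw [h]; exact zero_mem _)
  -- `p^j • f_m z′ = 0` forces `f_m z′ = 0`: the pin is `S_m`-torsion-free and `q_m ∤ p^j`
  rw [map_smul] at h0
  have hg : Ideal.Quotient.mk
      (Ideal.span {(PowerSeries.X ^ m + PowerSeries.C (p : ℤ_[p]) : IwasawaAlgebra p)})
        ((p : IwasawaAlgebra p) ^ j) ≠ 0 := by
    rw [Ne, Ideal.Quotient.eq_zero_iff_mem, Ideal.mem_span_singleton]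
    exact IwasawaAlgebra.not_X_pow_add_C_dvd_natCast_pow p hm j
  exact hz'0 (PrintX10bCompactControl.eisensteinH1Data_eq_zero_of_smul_eq_zero_of_mk_ne_zero κ hE hm t ht I _ hg _ h0)

end Summit.BirchSwinnertonDyer.BirchSwinnertonDyer.Theorems.UniversalToricDescentControlImageNonvanishing

end
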